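import Summits.ResolutionOfSingularities.ResolutionOfSingularities.Theorems.FrobeniusClosingPatchingRelPerfectConeDepthChartKill
import Literature.AlgebraicGeometry.Resolution.BlowupChartQuotients
import HarnessLib

/-!
# Crux `PatchingRelPerfect` (stmt-ResolutionOfSingularities-16161), chain W5.2 — rung «r-cone-ℓ», local algebra III: THE QUADRIC
# CONE `q = c₁c₂ + c₃²` ON THE CHARTS OF `Bl_𝔪 Spec R` (`R` regular local of dimension four) — set-up, packaging, and THE VERTEX

[OURS · L1 W5.2 · rung tool] Replaces the role of NO printed item; NOT a statement of the manuscript under review; fact-free,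
any characteristic, any residue field.  AI-written (AI review is weaker than expert review).

The rung «r-cone-ℓ» (res-L1-w52-stub-4 g4, crux `PatchingRelPerfect` stmt-ResolutionOfSingularities-16161, line
`closed_point_slice`, open stub `stub_atomDimFourBlowup`): the member `I = (x₀x₁ + x₂²) + 𝔪^{ℓ+2}` — the quadric CONE at
exceptional depth `ℓ` — lies in the companion class for EVERY `ℓ ≥ 1`.  It is the minimal family with an `(ℓ, 2)`-DEFICIENT step
(CHAIN v2.1 kernel sentence (v″): the vertex of `V(q̄) ⊂ ℙ³` is an ordinary double point, of weight `2 < ℓ` for `ℓ ≥ 3`), resolved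
by `⌈ℓ/2⌉` blowings up of successive vertices (each reproducing the cone on the new exceptional carrier at depth `ℓ - 2`:
`u²·((y₀/u)(y₁/u) + (y₂/u)², u^{ℓ-2})`) followed by the two-monomial END game (`atomConclusion_of_pointwiseTwoMonomial`).

This file, for `R` regular local with regular system of parameters `c₀, c₁, c₂, c₃` and the chart rings `B_i = (R[𝔪t])_{(c_i t)}`
of the tree (`chartRing`, `chartBase`, `chartGen`; `e_j = c_j/c_i`):
* `coneε` — the chart isomorphism `κ[T_j : j ≠ i] ≅ B_i/(c_i)` with RESIDUE-FIELD coefficients (the tree's `chartQuotEquiv` composed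
  with `R/𝔪 ≅ κ`), `coneε_C`, `coneε_X`;
* `coneFun c i = e₁e₂ + e₃²` and **`chartBase_cone`: `φ(c₁c₂ + c₃²) = φ(c_i)² · coneFun`** — the total transform of the cone is
  the square of the exceptional parameter times its strict transform;
* `rsopAdapted_of_cover` / `rsopAdapted_of_consFamily_killFamily` / `rsopAdapted_of_chartFamily` — packaging parts of regular
  systems of parameters as «the members of a list of chart elements lying in `𝔓` are among ONE regular system of parameters of
  `L`, distinct members at distinct indices» (the ring-level form of simple normal crossings at the point);
* `isRsopPart_cone_kill` — `…ConeDepthChartKill` specialised to the cone;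
* THE VERTEX: `vertexIdeal = (c₀, e₁, e₂, e₃) ⊂ B₀` is MAXIMAL (`B₀/(c₀, e₁, e₂, e₃) ≅ κ`, `isMaximal_vertexIdeal`), a prime over `𝔪`
  containing `e₁, e₂, e₃` IS it (`eq_vertexIdeal`), and there **`coneVertex`**: `(c₀, e₁, e₂, e₃)` is a regular system of parameters
  of `L` generating its maximal ideal, with `coneFun = e₁e₂ + e₃²` — the new vertex has the shape of the old one (depth drops by two
  upstream: `u^ℓ ↦ u^{ℓ-2}` after removing `u²`).
The charts off the vertex are in `…ConeDepthConeChartsOff`.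

## References
* H. Matsumura, *Commutative Ring Theory*, CUP 1986, Thm. 14.2 (and the Remark after it), Thm. 17.4. [Matsumura1987]
* The Stacks Project, Tags 0804, 0BIQ (charts of a blowing up, `B_i/(c_i) ≅ (R/I)[T]`). [StacksProject]
* J. Kollár, *Lectures on Resolution of Singularities* (2007), Def. 3.24, (3.111) Step 3. [Kollar2007]
-/

-- `Summit.<Summit>.<Sub>.Theorems` with `Sub = Summit` (single-conjunct summit, D-0017)
set_option linter.dupNamespace false

noncomputable section

open IsLocalRing Literature.AlgebraicGeometry.Resolution
open scoped Pointwise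

namespace Summit.ResolutionOfSingularities.ResolutionOfSingularities.Theorems

universe u v w

namespace ConeDepth

/-! ## §4 The quadric cone `q = c₁c₂ + c₃²` on the charts of `Bl_𝔪 Spec R`, `R` regular local of dimension four -/

section Cone

variable {R : Type u} [CommRing R] [IsRegularLocalRing R] (c : Fin 4 → R)
  (hz : Ideal.span (Set.range c) = maximalIdeal R) (hd : (maximalIdeal R).spanFinrank = 4) (i : Fin 4)

local notation3 "Bc" => chartRing c i
local notation3 "φc" => chartBase c i
local notation3 "ec[" j "]" => chartGen c i j

/-- The residue field of `R` as the quotient by the centre `(c) = 𝔪`. [folklore] -/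
def resEquiv : (R ⧸ Ideal.span (Set.range c)) ≃+* ResidueField R :=
  Ideal.quotEquivOfEq hz

/-- **The chart isomorphism with residue-field coefficients** `κ[T_j : j ≠ i] ≅ B_i/(c_i)`, `T_j ↦ e_j`. [cite: StacksProject, Tag 0BIQ] -/
def coneε : MvPolynomial {j : Fin 4 // j ≠ i} (ResidueField R) ≃+* Bc ⧸ Ideal.span {φc (c i)} :=
  (MvPolynomial.mapEquiv _ (resEquiv c hz).symm).trans (chartQuotEquiv c i (isQuasiRegular_centre c (Fin.elim0 : Fin 0 → R)
    (by rw [Fin.append_elim0, (Fin.rightInverse_cast (Nat.add_zero 4)).surjective.range_comp]; exact hz) hd))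

/-- `coneε` on constants. [folklore] -/
theorem coneε_C (r : R) : coneε c hz hd i (MvPolynomial.C (residue R r)) = Ideal.Quotient.mk _ (φc r) := by
  rw [coneε, RingEquiv.trans_apply, MvPolynomial.mapEquiv_apply, MvPolynomial.map_C, chartQuotEquiv_apply]
  exact chartQuotMap_C c i r

/-- `coneε` on variables. [folklore] -/
theorem coneε_X (j : {j : Fin 4 // j ≠ i}) : coneε c hz hd i (MvPolynomial.X j) = Ideal.Quotient.mk _ (ec[j.1]) := by
  rw [coneε, RingEquiv.trans_apply, MvPolynomial.mapEquiv_apply, MvPolynomial.map_X, chartQuotEquiv_apply, chartQuotMap_X]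

/-- **The cone on the chart**: `f_i = e₁e₂ + e₃²` (with `e_i = 1`). [folklore] -/
def coneFun : Bc := ec[1] * ec[2] + ec[3] ^ 2

omit [IsRegularLocalRing R] in
/-- **`φ(q) = φ(c_i)² · f_i`**: the total transform of the cone `q = c₁c₂ + c₃²` on the chart `B_i` is the square of the
exceptional parameter times `f_i`. [folklore] -/
theorem chartBase_cone : φc (c 1 * c 2 + c 3 ^ 2) = φc (c i) ^ 2 * coneFun c i := by
  rw [map_add, map_mul, map_pow, reesChartBase_apply_eq_mul_chartGen c i 1, reesChartBase_apply_eq_mul_chartGen c i 2,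
    reesChartBase_apply_eq_mul_chartGen c i 3, coneFun]
  ring

/-- **Adapted part of a regular system of parameters** (the ring-level content of «simple normal crossings at the point» for
the hypersurfaces `V(g)`, `g ∈ gs`): the members of `gs` lying in `𝔓` are, over `1`, among the members of ONE family that is part
of a regular system of parameters of `L`, distinct members getting distinct indices.  Constructor from a part of a regular system
of parameters `(w_k/1)_k` covering the members of `gs` in `𝔓`. [cite: Kollar2007, Def. 3.24] -/
theorem rsopAdapted_of_cover {A : Type u} [CommRing A] {L : Type u} [CommRing L] [IsLocalRing L] [Algebra A L]
    {𝔓 : Ideal A} {gs : List A} {m : ℕ} (w : Fin m → A) (hw : IsRsopPart (fun k => algebraMap A L (w k)))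
    (hcover : ∀ g ∈ gs, g ∈ 𝔓 → ∃ k, w k = g) :
    ∃ (m : ℕ) (v : Fin m → L) (ι : {g : A // g ∈ gs ∧ g ∈ 𝔓} → Fin m),
      IsRsopPart v ∧ Function.Injective ι ∧ ∀ g, v (ι g) = algebraMap A L g.1 := by
  classical
  refine ⟨m, fun k => algebraMap A L (w k), fun g => (hcover g.1 g.2.1 g.2.2).choose, hw, ?_, fun g => ?_⟩
  · intro g g' h
    apply Subtype.ext
    have h1 := (hcover g.1 g.2.1 g.2.2).choose_spec
    have h2 := (hcover g'.1 g'.2.1 g'.2.2).choose_spec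
    rw [← h1, ← h2]
    exact congrArg w h
  · simp only [(hcover g.1 g.2.1 g.2.2).choose_spec]

section Chart

variable (𝔓 : Ideal (chartRing c i)) [𝔓.IsPrime] (h𝔓 : 𝔓.comap (chartBase c i) = maximalIdeal R)
  (L : Type u) [CommRing L] [IsLocalRing L] [Algebra (chartRing c i) L] [IsLocalization.AtPrime L 𝔓]

include hz hd h𝔓 in
/-- The tree's chart family at an enumeration of chart generators in `𝔓`, in our setting (no further coordinates).
[cite: StacksProject, Tag 0BIQ] -/
theorem isRsopPart_chartFamily_cone {a : ℕ} (jJ : Fin a → {j : Fin 4 // j ≠ i}) (hjJ : Function.Injective jJ)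
    (hJ : ∀ k, ec[(jJ k).1] ∈ 𝔓) :
    IsRsopPart (chartFamily c i (Fin.elim0 : Fin 0 → R) L (chartBase c i) (chartGen c i) jJ) :=
  isRsopPart_chartFamily_reesChart c i Fin.elim0
    (by rw [Fin.append_elim0, (Fin.rightInverse_cast (Nat.add_zero 4)).surjective.range_comp]; exact hz) hd 𝔓 h𝔓 L jJ hjJ hJ

include hz hd h𝔓 in
/-- **The cone chart with killed generators**: for a duplicate-free list `l` of indices `j ≠ i` with `e_j ∈ 𝔓` and
`f_i ∈ 𝔓`, given a polynomial representative `F` of `f_i` over `κ` not involving the `T_l` with a partial derivative whose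
lift avoids `𝔓`, `(φ c_i, e_l, f_i)` is part of a regular system of parameters of `L`. [cite: Matsumura1987, Thm. 14.2] -/
theorem isRsopPart_cone_kill (l : List {j : Fin 4 // j ≠ i}) (hl : l.Nodup) (hlu : ∀ j ∈ l, ec[j.1] ∈ 𝔓)
    (hf : coneFun c i ∈ 𝔓)
    (F : MvPolynomial {j : {j : Fin 4 // j ≠ i} // j ∉ {j : {j : Fin 4 // j ≠ i} | j ∈ l}} (ResidueField R))
    (hF0 : F ≠ 0) (hfF : coneε c hz hd i (MvPolynomial.rename Subtype.val F) = Ideal.Quotient.mk _ (coneFun c i))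
    (jv : {j : {j : Fin 4 // j ≠ i} // j ∉ {j : {j : Fin 4 // j ≠ i} | j ∈ l}}) (a : Bc)
    (hGa : coneε c hz hd i (MvPolynomial.rename Subtype.val (MvPolynomial.pderiv jv F)) = Ideal.Quotient.mk _ a)
    (ha : a ∉ 𝔓) :
    IsRsopPart (consFamily c i L (chartBase c i) (killFamily i (chartGen c i) l (coneFun c i))) := by
  haveI : IsNoetherianRing Bc := isNoetherianRing_blowupChart c i
  exact isRsopPart_kill_hypersurface c i hz L (chartBase c i) (chartGen c i)
    (reesChartBase_mem_nonZeroDivisors (c i) (Ideal.mem_span_range_self (f := c) (x := i)))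
    (coneε c hz hd i) (coneε_X c hz hd i) 𝔓 h𝔓 l hl hlu (coneFun c i) hf F hF0 hfF jv a hGa ha

end Chart

section Packaging

variable (𝔓 : Ideal (chartRing c i)) [𝔓.IsPrime] (h𝔓 : 𝔓.comap (chartBase c i) = maximalIdeal R)
  (L : Type u) [CommRing L] [IsLocalRing L] [Algebra (chartRing c i) L] [IsLocalization.AtPrime L 𝔓]

omit [IsRegularLocalRing R] [𝔓.IsPrime] [IsLocalization.AtPrime L 𝔓] in
/-- Packaging a cons/kill family as an adapted family for a list of chart elements. [folklore] -/
theorem rsopAdapted_of_consFamily_killFamily (l : List {j : Fin 4 // j ≠ i}) (f : Bc)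
    (h : IsRsopPart (consFamily c i L (chartBase c i) (killFamily i (chartGen c i) l f)))
    (gs : List Bc) (hgs : ∀ g ∈ gs, g ∈ 𝔓 → g = φc (c i) ∨ (∃ j ∈ l, g = ec[j.1]) ∨ g = f) :
    ∃ (m : ℕ) (v : Fin m → L) (ι : {g : chartRing c i // g ∈ gs ∧ g ∈ 𝔓} → Fin m),
      IsRsopPart v ∧ Function.Injective ι ∧ ∀ g, v (ι g) = (algebraMap (chartRing c i) L : chartRing c i →+* L) g.1 := by
  refine rsopAdapted_of_cover (Fin.cons (φc (c i)) (killFamily i (chartGen c i) l f)) ?_ ?_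
  · convert h using 1
    funext k
    refine Fin.cases rfl (fun k => ?_) k
    simp only [Fin.cons_succ, consFamily]
  · intro g hg hgP
    rcases hgs g hg hgP with rfl | ⟨j, hj, rfl⟩ | rfl
    · exact ⟨0, rfl⟩
    · obtain ⟨k, rfl⟩ := List.get_of_mem hj
      refine ⟨(Fin.castAdd 1 k).succ, ?_⟩
      rw [Fin.cons_succ, killFamily, Fin.append_left]
    · refine ⟨(Fin.natAdd l.length (0 : Fin 1)).succ, ?_⟩
      rw [Fin.cons_succ, killFamily, Fin.append_right]

omit [IsRegularLocalRing R] [𝔓.IsPrime] [IsLocalization.AtPrime L 𝔓] in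
/-- Packaging the tree's chart family (no further coordinates) as an adapted family. [folklore] -/
theorem rsopAdapted_of_chartFamily {a : ℕ} (jJ : Fin a → {j : Fin 4 // j ≠ i})
    (h : IsRsopPart (chartFamily c i (Fin.elim0 : Fin 0 → R) L (chartBase c i) (chartGen c i) jJ))
    (gs : List Bc) (hgs : ∀ g ∈ gs, g ∈ 𝔓 → g = φc (c i) ∨ ∃ k, g = ec[(jJ k).1]) :
    ∃ (m : ℕ) (v : Fin m → L) (ι : {g : chartRing c i // g ∈ gs ∧ g ∈ 𝔓} → Fin m),
      IsRsopPart v ∧ Function.Injective ι ∧ ∀ g, v (ι g) = (algebraMap (chartRing c i) L : chartRing c i →+* L) g.1 := by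
  refine rsopAdapted_of_cover
    (Fin.cons (φc (c i)) (Fin.append (fun k => ec[(jJ k).1]) (fun k : Fin 0 => φc (Fin.elim0 k)))) ?_ ?_
  · convert h using 1
    funext k
    refine Fin.cases rfl (fun k => ?_) k
    rw [Fin.cons_succ, chartFamily, Fin.cons_succ]
    refine Fin.addCases (m := a) (n := 0) (fun k => ?_) (fun k => k.elim0) k
    rw [Fin.append_left, Fin.append_left]
  · intro g hg hgP
    rcases hgs g hg hgP with rfl | ⟨k, rfl⟩
    · exact ⟨0, rfl⟩
    · exact ⟨(Fin.castAdd 0 k).succ, by rw [Fin.cons_succ, Fin.append_left]⟩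

end Packaging

/-! ### The vertex (chart `i = 0`, the prime `(c₀, e₁, e₂, e₃)`) -/

section Vertex

/-- The index set of surviving chart generators after killing all of them is empty. [folklore] -/
theorem isEmpty_killAll : IsEmpty {j : Fin 4 // j ≠ (0 : Fin 4) ∧ j ∉ ({1, 2, 3} : Set (Fin 4))} :=
  ⟨fun ⟨j, hj0, hj⟩ => by
    fin_cases j
    · exact hj0 rfl
    all_goals simp at hj⟩

/-- **The vertex ideal** `(c₀, e₁, e₂, e₃)` of the chart `B₀` (as a stage ideal of `BlowupChartQuotients.lean`). [folklore] -/
def vertexIdeal : Ideal (chartRing c 0) :=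
  chartStageIdeal c 0 ⊥ ({1, 2, 3} : Set (Fin 4))

omit [IsRegularLocalRing R] in
/-- The members of the vertex ideal. [folklore] -/
theorem mem_vertexIdeal : chartBase c 0 (c 0) ∈ vertexIdeal c ∧ chartGen c 0 1 ∈ vertexIdeal c ∧
    chartGen c 0 2 ∈ vertexIdeal c ∧ chartGen c 0 3 ∈ vertexIdeal c :=
  ⟨reesChartBase_self_mem_chartStageIdeal c 0 ⊥ _, chartGen_mem_chartStageIdeal c 0 ⊥ (by simp),
    chartGen_mem_chartStageIdeal c 0 ⊥ (by simp), chartGen_mem_chartStageIdeal c 0 ⊥ (by simp)⟩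

omit [IsRegularLocalRing R] in
/-- The vertex ideal is generated by `c₀, e₁, e₂, e₃`: it is contained in every ideal containing them. [folklore] -/
theorem vertexIdeal_le {J : Ideal (chartRing c 0)} (h0 : chartBase c 0 (c 0) ∈ J) (h1 : chartGen c 0 1 ∈ J)
    (h2 : chartGen c 0 2 ∈ J) (h3 : chartGen c 0 3 ∈ J) : vertexIdeal c ≤ J := by
  rw [vertexIdeal, chartStageIdeal, Ideal.map_bot]
  refine sup_le (sup_le ((Ideal.span_singleton_le_iff_mem _).mpr h0) bot_le) (Ideal.span_le.mpr ?_)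
  rintro _ ⟨j, hj, rfl⟩
  simp only [Set.mem_insert_iff, Set.mem_singleton_iff] at hj
  rcases hj with rfl | rfl | rfl
  exacts [h1, h2, h3]

include hz hd in
/-- **The vertex ideal is maximal**: `B₀/(c₀, e₁, e₂, e₃) ≅ κ`. [cite: StacksProject, Tag 0BIQ] -/
theorem isMaximal_vertexIdeal : (vertexIdeal c).IsMaximal := by
  haveI : (Ideal.span (Set.range c)).IsMaximal := by rw [hz]; exact maximalIdeal.isMaximal R
  have e1 := chartStageEquiv c 0 (⊥ : Ideal R) ({1, 2, 3} : Set (Fin 4)) (isQuasiRegular_centre c (Fin.elim0 : Fin 0 → R)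
    (by rw [Fin.append_elim0, (Fin.rightInverse_cast (Nat.add_zero 4)).surjective.range_comp]; exact hz) hd) (by simp)
  haveI := isEmpty_killAll
  have e2 : MvPolynomial {j : Fin 4 // j ≠ (0 : Fin 4) ∧ j ∉ ({1, 2, 3} : Set (Fin 4))}
      (R ⧸ (Ideal.span (Set.range c) ⊔ ⊥)) ≃+* R ⧸ (Ideal.span (Set.range c) ⊔ ⊥) :=
    (MvPolynomial.isEmptyAlgEquiv _ _).toRingEquiv
  have e3 : (R ⧸ (Ideal.span (Set.range c) ⊔ ⊥)) ≃+* R ⧸ Ideal.span (Set.range c) := Ideal.quotEquivOfEq (sup_bot_eq _)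
  letI : Field (R ⧸ Ideal.span (Set.range c)) := Ideal.Quotient.field _
  refine Ideal.Quotient.maximal_of_isField _ ?_
  exact MulEquiv.isField (Field.toIsField _) (e1.symm.trans (e2.trans e3)).toMulEquiv


include hz hd in
/-- The vertex ideal lies over the maximal ideal of `R`. [folklore] -/
theorem comap_vertexIdeal : (vertexIdeal c).comap (chartBase c 0) = maximalIdeal R := by
  have hm := mem_vertexIdeal c
  refine ((maximalIdeal.isMaximal R).eq_of_le ?_ ?_).symm
  · exact Ideal.comap_ne_top _ (isMaximal_vertexIdeal c hz hd).ne_top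
  · rw [← hz, Ideal.span_le]
    rintro _ ⟨j, rfl⟩
    rw [SetLike.mem_coe, Ideal.mem_comap, reesChartBase_apply_eq_mul_chartGen c 0 j]
    fin_cases j
    · exact Ideal.mul_mem_right _ _ hm.1
    · exact Ideal.mul_mem_left _ _ hm.2.1
    · exact Ideal.mul_mem_left _ _ hm.2.2.1
    · exact Ideal.mul_mem_left _ _ hm.2.2.2

variable (𝔓 : Ideal (chartRing c 0)) [𝔓.IsPrime] (h𝔓 : 𝔓.comap (chartBase c 0) = maximalIdeal R)
  (L : Type u) [CommRing L] [IsLocalRing L] [Algebra (chartRing c 0) L] [IsLocalization.AtPrime L 𝔓]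

include hz hd h𝔓 in
/-- A prime over `𝔪` containing `e₁, e₂, e₃` IS the vertex ideal. [folklore] -/
theorem eq_vertexIdeal (h1 : chartGen c 0 1 ∈ 𝔓) (h2 : chartGen c 0 2 ∈ 𝔓) (h3 : chartGen c 0 3 ∈ 𝔓) :
    𝔓 = vertexIdeal c :=
  ((isMaximal_vertexIdeal c hz hd).eq_of_le (Ideal.IsPrime.ne_top inferInstance)
    (vertexIdeal_le c (map_centre_mem' c hz (chartBase c 0) 𝔓 h𝔓 0) h1 h2 h3)).symm

include hz hd h𝔓 in
/-- **At the vertex** (`e₁, e₂, e₃ ∈ 𝔓`): `(c₀, e₁, e₂, e₃)` (over `1`) is a regular system of parameters of `L`, and the cone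
reads `f₀ = e₁e₂ + e₃²` in it — the local ring at the new vertex has the same shape as the one we started from, at depth two less.
[cite: StacksProject, Tag 0BIQ] -/
theorem coneVertex (h1 : chartGen c 0 1 ∈ 𝔓) (h2 : chartGen c 0 2 ∈ 𝔓) (h3 : chartGen c 0 3 ∈ 𝔓) :
    ∃ v : Fin 4 → L, IsRsopPart v ∧ Ideal.span (Set.range v) = maximalIdeal L ∧
      v 0 = (algebraMap (chartRing c 0) L : chartRing c 0 →+* L) (chartBase c 0 (c 0)) ∧ v 1 = (algebraMap (chartRing c 0) L : chartRing c 0 →+* L) (chartGen c 0 1) ∧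
      v 2 = (algebraMap (chartRing c 0) L : chartRing c 0 →+* L) (chartGen c 0 2) ∧ v 3 = (algebraMap (chartRing c 0) L : chartRing c 0 →+* L) (chartGen c 0 3) ∧
      (algebraMap (chartRing c 0) L : chartRing c 0 →+* L) (coneFun c 0) = v 1 * v 2 + v 3 ^ 2 := by
  -- the enumeration `k ↦ k + 1` of the indices `1, 2, 3`
  let jJ : Fin 3 → {j : Fin 4 // j ≠ (0 : Fin 4)} := fun k => ⟨k.succ, Fin.succ_ne_zero k⟩
  have hjJ : Function.Injective jJ := fun k k' h => Fin.succ_injective _ (congrArg Subtype.val h)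
  have hJ : ∀ k, chartGen c 0 (jJ k).1 ∈ 𝔓 := by
    intro k; fin_cases k
    exacts [h1, h2, h3]
  have hv := isRsopPart_chartFamily_cone c hz hd 0 𝔓 h𝔓 L jJ hjJ hJ
  let v : Fin 4 → L := chartFamily c 0 (Fin.elim0 : Fin 0 → R) L (chartBase c 0) (chartGen c 0) jJ
  have hv0 : v 0 = (algebraMap (chartRing c 0) L : chartRing c 0 →+* L) (chartBase c 0 (c 0)) := rfl
  have hvs : ∀ k : Fin 3, v k.succ = (algebraMap (chartRing c 0) L : chartRing c 0 →+* L) (chartGen c 0 k.succ) := by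
    intro k
    change chartFamily c 0 Fin.elim0 L (chartBase c 0) (chartGen c 0) jJ (Fin.succ k) = _
    rw [chartFamily, Fin.cons_succ]
    exact Fin.append_left _ _ k
  refine ⟨v, hv, ?_, hv0, hvs 0, hvs 1, hvs 2, ?_⟩
  · -- `(v) = 𝔓L = 𝔪_L`, as `𝔓` is the vertex ideal, generated by the members of `v`
    rw [← IsLocalization.AtPrime.map_eq_maximalIdeal 𝔓 L]
    apply le_antisymm
    · rw [Ideal.span_le]
      rintro _ ⟨k, rfl⟩
      exact hv.mem_maximalIdeal k |> fun h => by rwa [← IsLocalization.AtPrime.map_eq_maximalIdeal 𝔓 L] at h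
    · rw [eq_vertexIdeal c hz hd 𝔓 h𝔓 h1 h2 h3, Ideal.map_le_iff_le_comap]
      refine vertexIdeal_le c ?_ ?_ ?_ ?_
      · exact Ideal.subset_span ⟨0, hv0.symm⟩
      · exact Ideal.subset_span ⟨1, (hvs 0).symm⟩
      · exact Ideal.subset_span ⟨2, (hvs 1).symm⟩
      · exact Ideal.subset_span ⟨3, (hvs 2).symm⟩
  · rw [coneFun, map_add, map_mul, map_pow]
    exact (congrArg₂ (· + ·) (congrArg₂ (· * ·) (hvs 0) (hvs 1)) (congrArg (· ^ 2) (hvs 2))).symm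

end Vertex

end Cone

end ConeDepth

end Summit.ResolutionOfSingularities.ResolutionOfSingularities.Theorems

end
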